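import Literature.AlgebraicGeometry.HodgeTheory.HomComplexPushforward
import Literature.AlgebraicGeometry.HodgeTheory.HomComplexUnit
import HarnessLib

/-!
# The unit `𝒪[0] ⟶ 𝓗om•(E•, E•)` along an isomorphism of schemes

Layer `Literature/AlgebraicGeometry/HodgeTheory`; sequel to `HomComplexUnit.lean` (`HomComplex.unit X E a b : 𝒪_X[0] ⟶ 𝓗om•(E•, E•)`,
degree-`0` component `Σ_{i ∈ [-b,-a]} (sheafHomUnit E^{-i} ≫ ι)`) and `HomComplexPushforward.lean` (`homComplexPushforwardIso ε E L :
ε_*• 𝓗om•(E•, L•) ≅ 𝓗om•(ε_*• E•, ε_*• L•)`). For an isomorphism of schemes `ε : Y₀ ≅ Y₁`: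

* `map_unitDeg₀_pushforward` — `ε♯ ≫ ε_*(unitDeg₀ E) ≫ (homComplexPushforwardIso).hom_0 = unitDeg₀ (ε_*• E)` (summand by summand:
  `unitPushforwardIso_hom_comp_map_sheafHomUnit` of `PushforwardIsoUnit.lean` and `map_ι_comp_homComplexPushforwardIso_hom_f`);
* **`single_map_unitPushforwardIso_comp_map_unit`** — the chain-map form: `𝒪_{Y₁}[0] ≅ ε_*•(𝒪_{Y₀}[0]) → ε_*• 𝓗om•(E•,E•) ≅
  𝓗om•(ε_*•E•, ε_*•E•)` equals `unit (ε_*• E•)` (Mathlib `singleMapHomologicalComplex`, `from_single_hom_ext`).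

Piece (N2) of the cell `pub-hodge-ring2`'s banked support target `HomComplex.IsISemiregularC.of_schemeIso` (the first arrow `Q(unit)` of the
venture HSemireg's `σ_q` along `ε_*`). Bookkeeping along an isomorphism (reading).
References: [BuchweitzFlenner2003] §2, Def. 4.1 (the unit / trace formalism); [Hartshorne1977] II §5 pp. 109–110; [Weibel1994] 2.7.4–2.7.5.
-/

noncomputable section

-- `TopCat.Presheaf`/`Scheme.Modules`/`GradedObject` are not reducible.
set_option backward.isDefEq.respectTransparency false

open CategoryTheory CategoryTheory.Category CategoryTheory.Limits AlgebraicGeometry Opposite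
open AlgebraicGeometry.Scheme.Modules

universe u

namespace Literature.AlgebraicGeometry.HodgeTheory

open Literature.AlgebraicGeometry.Modules Literature.Algebra.Homology

variable {Y₀ Y₁ : Scheme.{u}} (ε : Y₀ ≅ Y₁) (E : CochainComplex Y₀.Modules ℤ)

/-- **One unit summand along `ε_*`**: `ε♯ ≫ ε_*(sheafHomUnit E^{-i} ≫ ι_{-i,i}) ≫ (homComplexPushforwardIso).hom_0 = sheafHomUnit (ε_*E^{-i}) ≫ ι'`.
[cite: Hartshorne1977, II §5 pp. 109–110 (the sheaf Hom and direct images f_*; reading: bookkeeping along an isomorphism of schemes)] -/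
theorem map_unitSummand_pushforward (i : ℤ) :
    (unitPushforwardIso ε).hom ≫ (pushforward ε.hom).map (HomComplex.unitSummand Y₀ E i) ≫
        (homComplexPushforwardIso ε E E).hom.f 0 =
      HomComplex.unitSummand Y₁ (((pushforward ε.hom).mapHomologicalComplex (ComplexShape.up ℤ)).obj E) i := by
  rw [HomComplex.unitSummand, HomComplex.unitSummand, Functor.map_comp, Category.assoc,
    map_ι_comp_homComplexPushforwardIso_hom_f, ← Category.assoc, ← Category.assoc, Category.assoc (unitPushforwardIso ε).hom,
    unitPushforwardIso_hom_comp_map_sheafHomUnit]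
  rfl

/-- **The degree-`0` unit along `ε_*`**: `ε♯ ≫ ε_*(Σ_i unitSummand_i) ≫ (homComplexPushforwardIso).hom_0 = Σ_i unitSummand'_i`.
[cite: BuchweitzFlenner2003, §2 and Def. 4.1 (the unit of the trace formalism; reading: compatible with an isomorphism of the ambient scheme)] -/
theorem map_unitDeg₀_pushforward (a b : ℤ) :
    (unitPushforwardIso ε).hom ≫ (pushforward ε.hom).map (HomComplex.unitDeg₀ Y₀ E a b) ≫
        (homComplexPushforwardIso ε E E).hom.f 0 =
      HomComplex.unitDeg₀ Y₁ (((pushforward ε.hom).mapHomologicalComplex (ComplexShape.up ℤ)).obj E) a b := by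
  rw [HomComplex.unitDeg₀, HomComplex.unitDeg₀, Functor.map_sum, Preadditive.sum_comp, Preadditive.comp_sum]
  exact Finset.sum_congr rfl fun i _ => map_unitSummand_pushforward ε E i

variable (a b : ℤ) [E.IsStrictlyGE a] [E.IsStrictlyLE b]

/-- **The unit along an isomorphism of schemes** (chain-map form): the composite
`𝒪_{Y₁}[0] —ε♯[0]→ (ε_*𝒪_{Y₀})[0] ≅ ε_*•(𝒪_{Y₀}[0]) —ε_*•(unit E)→ ε_*• 𝓗om•(E•,E•) ≅ 𝓗om•(ε_*•E•, ε_*•E•)` is `unit (ε_*• E•)`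
(both are morphisms out of a single complex; compare degree-`0` components, `map_unitDeg₀_pushforward`).
[cite: BuchweitzFlenner2003, §2 and Def. 4.1 (the unit of the trace formalism; reading: compatible with an isomorphism of the ambient scheme)] -/
theorem single_map_unitPushforwardIso_comp_map_unit :
    (HomologicalComplex.single Y₁.Modules (ComplexShape.up ℤ) 0).map (unitPushforwardIso ε).hom ≫
        (HomologicalComplex.singleMapHomologicalComplex (pushforward ε.hom) (ComplexShape.up ℤ) 0).inv.app (unitModule Y₀) ≫
          ((pushforward ε.hom).mapHomologicalComplex (ComplexShape.up ℤ)).map (HomComplex.unit Y₀ E a b) ≫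
            (homComplexPushforwardIso ε E E).hom =
      HomComplex.unit Y₁ (((pushforward ε.hom).mapHomologicalComplex (ComplexShape.up ℤ)).obj E) a b := by
  apply HomologicalComplex.from_single_hom_ext
  rw [HomologicalComplex.comp_f, HomologicalComplex.comp_f, HomologicalComplex.comp_f, HomologicalComplex.single_map_f_self,
    HomologicalComplex.singleMapHomologicalComplex_inv_app_self, Functor.mapHomologicalComplex_map_f, HomComplex.unit,
    HomComplex.unit, HomologicalComplex.mkHomFromSingle_f, HomologicalComplex.mkHomFromSingle_f, Functor.map_comp]
  simp only [Category.assoc, Iso.inv_hom_id_assoc]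
  rw [← (pushforward ε.hom).map_comp_assoc, Iso.inv_hom_id, CategoryTheory.Functor.map_id]
  congr 1
  rw [Category.id_comp]
  exact map_unitDeg₀_pushforward ε E a b

end Literature.AlgebraicGeometry.HodgeTheory

end
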